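import Summits.AnomalousDissipation.AnomalousDissipation.Theses.EulerLimit
import Summits.AnomalousDissipation.AnomalousDissipation.Cruxes.EulerlimitThesisV2.Lines.tight
import Literature.Analysis.FluidPDE.NovackBallAvgBalance
import Literature.Analysis.FunctionSpaces.TorusMollifiedFields

/-!
# Stub-ideation sketch (ideator 3, FAMILY 3 — probe the extremes) for
`stub_loudTightFamily` of line `tight` (crux `EulerLimit.EulerlimitThesisV2`, stmt-AnomalousDissipation-0511).

Helper-lemma SIGNATURES only (`sorry` bodies; none is registered, none touches the skeleton).
Plans: A (extremal-clause analysis: which clauses of S1 are forced by the others),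
B (period-integrated KHM + anti-alignment ⇒ uniform `L³` space modulus),
C (steady Grashof extreme: amplitude rescaling of steady witnesses).
-/

noncomputable section

set_option linter.dupNamespace false

open Filter Set MeasureTheory Function
open scoped ENNReal InnerProductSpace RealInnerProductSpace
open Literature.Analysis.FunctionSpaces Literature.Analysis.FunctionSpaces.Torus
open Literature.Analysis.FluidPDE.Torus

namespace Summit.AnomalousDissipation.AnomalousDissipation.Cruxes.EulerlimitThesisV2.TightIdeas3

open Summit.AnomalousDissipation.AnomalousDissipation.Cruxes.EulerlimitThesisV2.Tight

local notation "𝕋³" => UnitAddTorus (Fin 3)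
local notation "E³" => EuclideanSpace ℝ (Fin 3)

/-! ## Shared objects -/

/-- Junk-free space–time `L³` translation functional of the stub: `∫₀^τ∫ ‖v(t+s, x+h) − v(t,x)‖³`. -/
def stMod (τ : ℝ) (v : ℝ → 𝕋³ → E³) (s : ℝ) (h : 𝕋³) : ℝ≥0∞ :=
  ∫⁻ t in Ioo 0 τ, ∫⁻ x, ‖v (t + s) (x + h) - v t x‖ₑ ^ 3

/-- `L³((0,τ)×𝕋³)` mass, junk-free. -/
def l3Mass (τ : ℝ) (v : ℝ → 𝕋³ → E³) : ℝ≥0∞ :=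
  ∫⁻ t in Ioo 0 τ, ∫⁻ x, ‖v t x‖ₑ ^ 3

/-- Sphere-averaged ABSOLUTE third-order structure function `⨍_{S²} ‖δu(x;ℓω)‖³ dω`
(the absolute 4/5-law object; companion of `energyFluxSphereAvg`). -/
def absThirdSphereAvg (w : 𝕋³ → E³) (ℓ : ℝ) (x : 𝕋³) : ℝ :=
  sphereAvg fun ω => ‖increment w (ℓ • ω) x‖ ^ 3

/-- **S1♭ — the shrunken heart (Plan A target).** Verbatim `stub_loudTightFamily` with the `L³`-mass
clause DELETED and the modulus clause SPACE-ONLY (`s = 0`): uniform smallness of the absolute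
third-order structure function over a period. -/
def LoudSpaceTightFamily : Prop :=
    ∃ f : 𝕋³ → E³, IsSmooth f ∧ IsDivFree f ∧ HasZeroMean f ∧
      ∃ (τ c E : ℝ), 0 < τ ∧ 0 < c ∧
        ∃ (ν : ℕ → ℝ) (us : ℕ → ℝ → 𝕋³ → E³) (ps : ℕ → ℝ → 𝕋³ → ℝ),
          (∀ j, 0 < ν j) ∧ Tendsto ν atTop (nhds 0) ∧
          (∀ j, IsClassicalNSSolutionOn univ (ν j) (fun _ => f) (us j) (ps j) ∧ Periodic (us j) τ) ∧
          (∀ j t, ∫ x, ‖us j t x‖ ^ 2 ≤ E) ∧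
          (∀ j, c ≤ ∫ t in (0 : ℝ)..τ, ∫ x, ⟪f x, us j t x⟫_ℝ) ∧
          (∀ ε : ℝ, 0 < ε → ∃ δ : ℝ, 0 < δ ∧ ∀ (j : ℕ) (h : 𝕋³), ‖h‖ ≤ δ →
              stMod τ (us j) 0 h ≤ ENNReal.ofReal ε)

/-! ## Plan A — extremal-clause analysis: `S1♭ → S1` -/

/-- **HA1 (Jensen, rough part; M).** Distance to the torus mollification is controlled by the space
modulus at scales `≤ δ` (kernel nonneg, unit mass, supported in the `δ`-ball:
`Torus.kernel_nonneg`, `integral_kernel`, `support_kernel_subset`). -/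
theorem HA1_lintegral_sub_vecMollify_le (τ δ : ℝ) (hτ : 0 < τ) (hδ : 0 < δ) (hδ' : δ ≤ 1 / 4)
    (v : ℝ → 𝕋³ → E³) (hv : IsSmoothSpaceTimeOn univ v) (B : ℝ≥0∞)
    (hmod : ∀ h : 𝕋³, ‖h‖ ≤ δ → stMod τ v 0 h ≤ B) :
    ∫⁻ t in Ioo 0 τ, ∫⁻ x, ‖v t x - vecMollify δ (v t) x‖ₑ ^ 3 ≤ B := by
  sorry

/-- **HA2 (Cauchy–Schwarz, smooth part is bounded; S–M).** `‖(K_δ ⋆ w)(x)‖² ≤ ‖K_δ‖₂² ‖w‖₂²`. -/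
theorem HA2_norm_vecMollify_sq_le (δ : ℝ) (hδ : 0 < δ) (hδ' : δ ≤ 1 / 4) (w : 𝕋³ → E³)
    (hw : Continuous w) (x : 𝕋³) :
    ‖vecMollify δ w x‖ ^ 2 ≤ (∫ z : 𝕋³, kernel δ z ^ 2) * ∫ y, ‖w y‖ ^ 2 := by
  sorry

/-- **HA3 (assembly of HA1+HA2; S): the `L³`-mass clause of S1 is REDUNDANT.** Energy bound + space
modulus at ONE scale bound the `L³((0,τ)×𝕋³)` mass, with a constant depending only on `(τ, E, ε₀, δ₀)`. -/
theorem HA3_l3Mass_le_of_energy_of_spaceModulus (τ E ε₀ δ₀ : ℝ) (hτ : 0 < τ) (hδ₀ : 0 < δ₀) :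
    ∃ M : ℝ, ∀ v : ℝ → 𝕋³ → E³, IsSmoothSpaceTimeOn univ v → (∀ t, ∫ x, ‖v t x‖ ^ 2 ≤ E) →
      (∀ h : 𝕋³, ‖h‖ ≤ δ₀ → stMod τ v 0 h ≤ ENNReal.ofReal ε₀) →
      l3Mass τ v ≤ ENNReal.ofReal M := by
  sorry

/-- **HA4 (equation ⇒ mollified field is Lipschitz in time, uniformly in `ν ≤ 1`; M–L).** Test the
momentum equation against the LERAY-PROJECTED kernel `ℙ(K_δ(x−·)eᵢ)` (`Torus.smooth_leray_helmholtz_holds`):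
the pressure drops, `|∂ₜ(K_δ ⋆ uᵢ)(t,x)| ≤ ‖∇ℙφ‖_∞ E + ν‖Δℙφ‖₂ E^{1/2} + ‖f‖₂ ‖ℙφ‖₂`. -/
theorem HA4_vecMollify_time_lipschitz (f : 𝕋³ → E³) (hf : IsSmooth f) (E δ : ℝ) (hδ : 0 < δ)
    (hδ' : δ ≤ 1 / 4) :
    ∃ L : ℝ, ∀ (ν : ℝ) (u : ℝ → 𝕋³ → E³) (p : ℝ → 𝕋³ → ℝ), 0 < ν → ν ≤ 1 →
      IsClassicalNSSolutionOn univ ν (fun _ => f) u p → (∀ t, ∫ x, ‖u t x‖ ^ 2 ≤ E) →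
      ∀ (t s : ℝ) (x : 𝕋³), ‖vecMollify δ (u (t + s)) x - vecMollify δ (u t) x‖ ≤ L * |s| := by
  sorry

/-- **HA5 (assembly of HA1+HA4; S–M): time modulus from space modulus, uniformly in `ν ≤ 1`.**
Given the target `ε`, the lemma names the space tolerance `η` the family must meet; given the scale
`δ` at which it meets it, the lemma returns the time window `δ'`. -/
theorem HA5_timeModulus_of_spaceModulus (f : 𝕋³ → E³) (hf : IsSmooth f) (τ E : ℝ) (hτ : 0 < τ)
    (ε : ℝ) (hε : 0 < ε) :
    ∃ η : ℝ, 0 < η ∧ ∀ δ : ℝ, 0 < δ → ∃ δ' : ℝ, 0 < δ' ∧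
      ∀ (ν : ℝ) (u : ℝ → 𝕋³ → E³) (p : ℝ → 𝕋³ → ℝ), 0 < ν → ν ≤ 1 →
        IsClassicalNSSolutionOn univ ν (fun _ => f) u p → Periodic u τ →
        (∀ t, ∫ x, ‖u t x‖ ^ 2 ≤ E) →
        (∀ h : 𝕋³, ‖h‖ ≤ δ → stMod τ u 0 h ≤ ENNReal.ofReal η) →
        ∀ s : ℝ, |s| ≤ δ' → stMod τ u s 0 ≤ ENNReal.ofReal ε := by
  sorry

/-- **HA6 (period shift invariance; S).** For a `τ`-periodic integrand the window `(0,τ)` may be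
shifted: reduces the mixed modulus to space-at-shifted-time + pure time. -/
theorem HA6_stMod_le_space_add_time (τ : ℝ) (hτ : 0 < τ) (v : ℝ → 𝕋³ → E³)
    (hv : IsSmoothSpaceTimeOn univ v) (hper : Periodic v τ) (s : ℝ) (h : 𝕋³) :
    stMod τ v s h ≤ 4 * (stMod τ v 0 h + stMod τ v s 0) := by
  sorry

/-- **Plan A assembly: `S1♭ → S1`** (HA3 + HA5 + HA6; drop to `ν j ≤ 1` eventually by `ν → 0`
and reindex). -/
theorem stub_loudTightFamily_of_loudSpaceTight (h : LoudSpaceTightFamily) :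
    Statement.stub_loudTightFamily := by
  sorry

/-! ## Plan B — period-integrated KHM at scale `ℓ` + anti-alignment ⇒ `S1♭` -/

/-- **HB1 (period-integrated Kármán–Howarth–Monin / Duchon–Robert balance with the BALL kernel for
classical `τ`-periodic NS(ν, f), steady smooth force; L–XL).** Space- and period-integration kill
`∂ₜ(u·u^ℓ)` and every divergence; ball average is `L²`-self-adjoint, so
`∫₀^τ∫ ⨍_{S²}(δu·ω)|δu|²(ℓω) = −(4ℓ/3)·(∫₀^τ∫⟪f, u^ℓ⟫ + ν∫₀^τ∫⟪Δu, u^ℓ⟫)`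
(Novack 2024 §2 Step 1 with `γ = 0`, `D_{I,ℓ,0} = −(3/(4ℓ))·energyFluxSphereAvg`, plus the
`νΔu + f` sources; smooth case of the tree's `novack2024_ballAvg_balance_holds`). -/
theorem HB1_period_KHM_ballAvg (f : 𝕋³ → E³) (hf : IsSmooth f) {ν τ : ℝ} (hν : 0 < ν) (hτ : 0 < τ)
    {u : ℝ → 𝕋³ → E³} {p : ℝ → 𝕋³ → ℝ} (hsol : IsClassicalNSSolutionOn univ ν (fun _ => f) u p)
    (hper : Periodic u τ) {ℓ : ℝ} (hℓ : 0 < ℓ) (hℓ' : ℓ < 1 / 2) :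
    ∫ t in Ioo 0 τ, ∫ x, energyFluxSphereAvg (u t) ℓ x =
      -(4 * ℓ / 3) * ((∫ t in Ioo 0 τ, ∫ x, ⟪f x, ballAvg (u t) ℓ x⟫_ℝ) +
        ν * ∫ t in Ioo 0 τ, ∫ x, ⟪laplacian (u t) x, ballAvg (u t) ℓ x⟫_ℝ) := by
  sorry

/-- **HB2 (uniform-in-ν flux bound = rigorous upper "4/3 law"; M).** From HB1, the period energy
identity `ν∫₀^τ‖∇u‖₂² = ∫₀^τ∫⟪f,u⟫ ≤ τ‖f‖₂E^{1/2}` (`IsClassicalNSSolutionOn.energy_balance_holds` +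
periodicity) and `|⟪Δu, u^ℓ⟫_{L²}| ≤ ‖∇u‖₂²` (ball average contracts, commutes with `∇`):
`|∫₀^τ∫ energyFluxSphereAvg| ≤ (8ℓ/3)·τ‖f‖₂√E`, for ALL `0 < ℓ < 1/2`, uniformly in `ν > 0`. -/
theorem HB2_abs_flux_le (f : 𝕋³ → E³) (hf : IsSmooth f) {ν τ E : ℝ} (hν : 0 < ν) (hτ : 0 < τ)
    {u : ℝ → 𝕋³ → E³} {p : ℝ → 𝕋³ → ℝ} (hsol : IsClassicalNSSolutionOn univ ν (fun _ => f) u p)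
    (hper : Periodic u τ) (hE : ∀ t, ∫ x, ‖u t x‖ ^ 2 ≤ E) {ℓ : ℝ} (hℓ : 0 < ℓ) (hℓ' : ℓ < 1 / 2) :
    |∫ t in Ioo 0 τ, ∫ x, energyFluxSphereAvg (u t) ℓ x| ≤
      8 * ℓ / 3 * (τ * Real.sqrt (∫ x, ‖f x‖ ^ 2) * Real.sqrt E) := by
  sorry

/-- **Uniform anti-alignment at small scales (Drivas 2022, Hyp. 2 (b*), period-integrated, NS side).**
The signed flux dominates a `|ℓ|^β` fraction of the absolute third moment. -/
def PeriodAligned (β C' ℓ₀ τ : ℝ) (u : ℝ → 𝕋³ → E³) : Prop :=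
  ∀ ℓ : ℝ, 0 < ℓ → ℓ ≤ ℓ₀ →
    C' * ℓ ^ β * ∫ t in Ioo 0 τ, ∫ x, absThirdSphereAvg (u t) ℓ x ≤
      -(∫ t in Ioo 0 τ, ∫ x, energyFluxSphereAvg (u t) ℓ x)

/-- **HB3 (algebra; S).** HB2 + alignment ⇒ sphere-averaged absolute structure function `≲ ℓ^{1-β}`
uniformly in `ν`. -/
theorem HB3_absThird_le_of_aligned (f : 𝕋³ → E³) (hf : IsSmooth f) {ν τ E β C' ℓ₀ : ℝ} (hν : 0 < ν)
    (hτ : 0 < τ) (hC' : 0 < C') (hℓ₀ : ℓ₀ < 1 / 2) {u : ℝ → 𝕋³ → E³} {p : ℝ → 𝕋³ → ℝ}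
    (hsol : IsClassicalNSSolutionOn univ ν (fun _ => f) u p) (hper : Periodic u τ)
    (hE : ∀ t, ∫ x, ‖u t x‖ ^ 2 ≤ E) (hal : PeriodAligned β C' ℓ₀ τ u) {ℓ : ℝ} (hℓ : 0 < ℓ)
    (hℓ' : ℓ ≤ ℓ₀) :
    ∫ t in Ioo 0 τ, ∫ x, absThirdSphereAvg (u t) ℓ x ≤
      8 * τ * Real.sqrt (∫ x, ‖f x‖ ^ 2) * Real.sqrt E / (3 * C') * ℓ ^ (1 - β) := by
  sorry

/-- **HB4 (de-averaging: sphere-averaged modulus ⇒ sup modulus; M–L).** `δ_h u(x) = δ_y u(x) −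
δ_{y−h}u(x+h)`, average `y` over `B(0,‖h‖)`, polar coordinates (`Measure.toSphere`,
`measurePreserving_homeomorphUnitSphereProd`) and translation invariance on `𝕋³`. -/
theorem HB4_stMod_le_of_absThirdSphereAvg (τ A γ ℓ₀ : ℝ) (hτ : 0 < τ) (hγ : 0 < γ) (hℓ₀ : 0 < ℓ₀)
    (hℓ₀' : ℓ₀ < 1 / 2) (v : ℝ → 𝕋³ → E³) (hv : IsSmoothSpaceTimeOn univ v)
    (hA : ∀ ℓ : ℝ, 0 < ℓ → ℓ ≤ ℓ₀ → ∫ t in Ioo 0 τ, ∫ x, absThirdSphereAvg (v t) ℓ x ≤ A * ℓ ^ γ)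
    (h : 𝕋³) (hh : ‖h‖ ≤ ℓ₀ / 2) :
    stMod τ v 0 h ≤ ENNReal.ofReal (4 * (1 + 8 * 2 ^ γ) * A * ‖h‖ ^ γ) := by
  sorry

/-- **The re-cut heart of Plan B: a loud, energy-bounded, uniformly ANTI-ALIGNED periodic family.**
(No modulus, no `L³` mass: both become theorems.) -/
def LoudAlignedFamily : Prop :=
    ∃ f : 𝕋³ → E³, IsSmooth f ∧ IsDivFree f ∧ HasZeroMean f ∧
      ∃ (τ c E β C' ℓ₀ : ℝ), 0 < τ ∧ 0 < c ∧ β < 1 ∧ 0 < C' ∧ 0 < ℓ₀ ∧ ℓ₀ < 1 / 2 ∧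
        ∃ (ν : ℕ → ℝ) (us : ℕ → ℝ → 𝕋³ → E³) (ps : ℕ → ℝ → 𝕋³ → ℝ),
          (∀ j, 0 < ν j) ∧ Tendsto ν atTop (nhds 0) ∧
          (∀ j, IsClassicalNSSolutionOn univ (ν j) (fun _ => f) (us j) (ps j) ∧ Periodic (us j) τ) ∧
          (∀ j t, ∫ x, ‖us j t x‖ ^ 2 ≤ E) ∧
          (∀ j, c ≤ ∫ t in (0 : ℝ)..τ, ∫ x, ⟪f x, us j t x⟫_ℝ) ∧
          (∀ j, PeriodAligned β C' ℓ₀ τ (us j))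

/-- **Plan B assembly: `LoudAlignedFamily → S1♭`** (HB3 + HB4 with `γ = 1 − β > 0`; then Plan A gives S1). -/
theorem loudSpaceTight_of_loudAligned (h : LoudAlignedFamily) : LoudSpaceTightFamily := by
  sorry

/-! ## Plan C — the steady (Grashof) extreme: amplitude rescaling of steady witnesses -/

/-- **HC1 (steady amplitude covariance on `𝕋³`; S–M).** A steady classical solution for the force
`μ • f` rescales to one for `f` itself at viscosity `μ^{-1/2} ν` (torus twin of
`IsClassicalNSSolutionOn.stRescale` with `γ = 1`; for steady fields the time dilation is invisible). -/
theorem HC1_steady_amplitude_rescale {ν μ : ℝ} (hμ : 0 < μ) {f U : 𝕋³ → E³} {P : 𝕋³ → ℝ}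
    (h : IsClassicalNSSolutionOn univ ν (fun _ => μ • f) (fun _ => U) (fun _ => P)) :
    IsClassicalNSSolutionOn univ (μ ^ (-(1 / 2 : ℝ)) * ν) (fun _ => f)
      (fun _ => μ ^ (-(1 / 2 : ℝ)) • U) (fun _ => μ⁻¹ • P) := by
  sorry

/-- **Steady Grashof family (Plan C heart).** Unit viscosity, force `G • f`, STEADY classical
solutions `v_G` whose normalised input stays positive and whose normalised fields are `L³`-space-tight. -/
def SteadyGrashofTightFamily : Prop :=
    ∃ f : 𝕋³ → E³, IsSmooth f ∧ IsDivFree f ∧ HasZeroMean f ∧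
      ∃ (c E : ℝ), 0 < c ∧
        ∃ (G : ℕ → ℝ) (vs : ℕ → 𝕋³ → E³) (qs : ℕ → 𝕋³ → ℝ),
          (∀ j, 0 < G j) ∧ Tendsto G atTop atTop ∧
          (∀ j, IsClassicalNSSolutionOn univ 1 (fun _ => G j • f) (fun _ => vs j) (fun _ => qs j)) ∧
          (∀ j, ∫ x, ‖vs j x‖ ^ 2 ≤ E * G j) ∧
          (∀ j, c * (G j) ^ (3 / 2 : ℝ) ≤ G j * ∫ x, ⟪f x, vs j x⟫_ℝ) ∧
          (∀ ε : ℝ, 0 < ε → ∃ δ : ℝ, 0 < δ ∧ ∀ (j : ℕ) (h : 𝕋³), ‖h‖ ≤ δ →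
              ∫⁻ x, ‖(G j) ^ (-(1 / 2 : ℝ)) • (vs j (x + h) - vs j x)‖ₑ ^ 3 ≤ ENNReal.ofReal ε)

/-- **Plan C assembly: `SteadyGrashofTightFamily → S1♭`** (HC1 with `μ = G j`, `ν j = (G j)^{-1/2} → 0`,
any `τ > 0`; time clauses vacuous for steady fields). -/
theorem loudSpaceTight_of_steadyGrashof (h : SteadyGrashofTightFamily) : LoudSpaceTightFamily := by
  sorry

end Summit.AnomalousDissipation.AnomalousDissipation.Cruxes.EulerlimitThesisV2.TightIdeas3
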